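import Mathlib
import HarnessLib
import HarnessLib.Audit
import Summits.AtomisticToContinuum.Statement
import Literature.MathematicalPhysics.QuantumManyBody.PeriodicBoseGas
import Literature.MathematicalPhysics.QuantumLattice.XYOrder
import Literature.Barriers.AtomisticToContinuum.FeynmanCyclesVersusCondensation
import Summits.AtomisticToContinuum.BoseEinsteinCondensation.Theorems.BECGroundStateSOSPeriodicEnergyFinite

/-!
Route: BECThermalMonotonicity

CLOSED (retired) 2026-08-15T13:40:58Z by operator:999:1257524 — reason: not-a-thesis: assembly does not conclude the sub-problem Statement — note: D-0027 §2.1 audit (human 2026-08-15: routes that do not decide the summit are removed): the assembly concludes `Literature.MathematicalPhysics.QuantumManyBody.BoseGas.BoseEinsteinCondensation`, not the sub-problem statement; a NEW conforming route may be opened from the same idea (generated `closes . The file is kept as the record of this route; refuted decls are indexed as negative knowledge (`ledger negatives`).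

# Route BECThermalMonotonicity — heating only depletes — a beta-monotone condensate occupation turns
BEC at one positive temperature into ground-state BEC

X = ThermalMonotonicity ∧ ThermalBEC (card heating-only-depletes-thermal-bridge, items M1 and M3).
"It suffices to show":
(M_T) HEATING ONLY DEPLETES — for every repulsive finite-range v, at all small densities ρ and all
large N, the canonical
Gibbs expectation ⟨n₀⟩_{β,N,L} of the zero-momentum occupation of N bosons on the torus of side L =
(N/ρ)^{1/3} is
non-decreasing in β (equivalently the energy–condensate covariance ⟨H ; n₀⟩_β ≤ 0, a
Griffiths/Ginibre-type inequality in the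
untried variable β); and (T>0 INPUT, the CONDITIONAL part) ⟨n₀⟩_{β(ρ),N,L} ≥ cN at ONE inverse
temperature β(ρ), uniformly in N.
Then ⟨n₀⟩ only grows as β → ∞ at fixed (N, L), the ground state inherits n₀ ≥ cN (support
ZeroTemperatureLimit,
PeriodicGroundStateEnergyFinite), i.e. PeriodicBEC of route BECPeriodicReduction holds, and
BoundaryTransferWeak (shared item
stmt-AtomisticToContinuum-0827) carries it to the Dirichlet conjunct. Gibbs expectations are typed
OPERATOR-FREE, in the conjunct's own
variational vocabulary, by the Gibbs variational principle: ⟨n₀⟩_β := sup_{δ>0} inf { Σᵢ pᵢ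
⟨Ψᵢ,n₀Ψᵢ⟩ : (Ψᵢ)ᵢ finite orthonormal
family of periodic C¹ trial states, p a probability vector, Σᵢ pᵢ⟨Ψᵢ,HΨᵢ⟩ + β⁻¹Σᵢ pᵢ log pᵢ within δ
of every other such family }
(Pinsker: F(Γ) − F(Γ_β) = β⁻¹S(Γ‖Γ_β) ≥ ‖Γ − Γ_β‖₁²/2β makes this the true canonical expectation).
CONDITIONAL IN SUBSTANCE (not flagged conditional_bridge only because the T > 0 input is not a
catalogued named conjecture): ThermalBEC
(rank 3) is positive-temperature BEC for an interacting continuum gas — open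
(LiebSeiringerSolovejYngvason2005 §1.2; only T_c upper bounds,
SeiringerUeltschi2009; GP scaling, DeuchertSeiringer2020); the route's OWN content is rank 2 (with
the probes rank 4 and the ideal-gas
support) plus the descent, and it makes ANY future proof of ThermalBEC close the conjunct.
Lean: `ThermalMonotonicity ∧ ThermalBEC`

## Assembly
Order lemmas only, no analysis (checked informally against the inline definitions; rc 0 in
Sketch.lean as a Prop). Fix v, hv. Take ρ₀ =
min of the four thresholds of ThermalMonotonicity, ZeroTemperatureLimit,
PeriodicGroundStateEnergyFinite, ThermalBEC; for ρ < ρ₀ get β₀, c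
from ThermalBEC and intersect the four eventual-in-N sets (and N ≥ 1). For such N: ofReal(cN) ≤
⟨n₀⟩_β₀ ≤ ⟨n₀⟩_β for every β ≥ β₀
(monotonicity); E₀^per ≠ ⊤ (finiteness) fires ZeroTemperatureLimit: ∀ε>0 ∀ᶠβ, ⟨n₀⟩_β ≤ G + ε with G
:= sup_δ inf_(near-min) n₀; choosing
β ≥ β₀ in the eventual set gives ofReal(cN) ≤ G + ε for all ε > 0, hence ofReal(cN) ≤ G
(ENNReal.le_of_forall_pos_le_add); since
ofReal(cN/2) < ofReal(cN) ≤ G = ⨆δ ⨅, lt_iSup_iff yields δ > 0 with ofReal((c/2)N) ≤ ⨅ over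
δ-near-minimisers ≤ n₀(Ψ) for each of them
(iInf_le) — this is exactly the hypothesis PeriodicBEC(v) of BoundaryTransferWeak with constant c/2,
which returns ∃ρ₀' ∀ρ<ρ₀'
HasGroundStateBEC v ρ, the conjunct's conclusion for v. About 100 lines of Lean;
XYThermalMonotonicity and IdealGasThermalMonotonicity are
probes/special cases and do not enter.

Rationale: WHY THIS LINE. Every one-parameter regularisation used so far improves condensation AWAY from the
physical point (source field λ:
Literature.Barriers.AtomisticToContinuum.SymmetryBreakingWithoutCondensate; pinning κ/L²: route
BECPinning; curvature: Lemm–Siebert; box size: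
KineticGapLengthScales), so convexity/monotonicity only ever transports UPPER bounds; temperature is
the one deformation whose favourable end
IS the conjunct (T = 0), and d⟨n₀⟩/dβ = −⟨H ; n₀⟩_β is an ordinary covariance (H commutes with
e^{−βH}), the bosonic U(1) analogue of
Griffiths II / Ginibre1970 (plane rotators), Gallavotti1971 and BenassiLeesUeltschi2016
(arXiv:1510.03215 Thm 1, Cor 2: monotonicity in the
COUPLINGS J¹, J² of the S = ½ XY model, the two contributions to the β-derivative carrying opposite
signs, so β itself is exactly the gap
they leave). Imported: correlation-inequality technology (classical/quantum lattice statistical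
mechanics; Ginibre cones, loop/FKG
representations — bosons are stoquastic at every β), the Gibbs variational principle + Pinsker
(quantum information) to type thermal states
without operators, and — through the conditional slot ThermalBEC — the whole positive-temperature
literature (SeiringerUeltschi2009,
DeuchertSeiringer2020, HaberbergerEtAl2023, FournaisEtAl2024, and card
thermal-window-classical-infrared, whose P1–P3 engine is the intended
supplier and whose P4 is this route's rank-2 crux). What no prior route does: BECInfraredBound /
BECRenormGroup / BECPinning /
BECPeriodicReduction are all T = 0 lines; the only T → 0 descent in print (KLS1988PRL) is welded to
Gaussian domination; the negatives
index is empty.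

RANKED CRUXES. #2 ThermalMonotonicity (crux) — (card M1, torus form, dilute and eventual in N) for
every repulsive finite-range v there is ρ₀ > 0 such that for 0 < ρ < ρ₀ and all large N, with L =
(N/ρ)^(1/3): for all 0 < β₁ ≤ β₂ the canonical Gibbs expectation of the constant-mode occupation n₀
= a₀†a₀ satisfies ⟨n₀⟩_(β₁,N,L) ≤ ⟨n₀⟩_(β₂,N,L) — heating only depletes; ⟨n₀⟩_β written
operator-free as sup_δ inf over δ-near-Gibbs finite orthonormal families of periodic trial states
(Gibbs variational principle). [difficulty: L] (why it might fail: At fixed (N,L) the large-β sign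
is that of n₀(Ψ₀)−n₀(Ψ₁): one low collective level more condensed than the ground state (finite-N
level crossing surviving dilution) refutes it; no Ginibre cone/FKG structure is known for the Bose
loop measure; quantum Griffiths II fails in general (HurstSherman1969).) [Ginibre1970,
Gallavotti1971, BenassiLeesUeltschi2016, arXiv:1510.03215, HurstSherman1969, FrohlichPark1978,
FrohlichPark1980, LiebSeiringerSolovejYngvason2005, KLS1988PRL, Ueltschi2006]
#3 ThermalBEC (crux) — (card M3; the CONDITIONAL input) positive-temperature BEC at ONE temperature,
uniformly in the particle number: for every repulsive finite-range v there is ρ₀ > 0 such that for 0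
< ρ < ρ₀ there are β > 0 and c > 0 with ⟨n₀⟩_(β,N,(N/ρ)^(1/3)) ≥ cN for all large N (canonical Gibbs
state on the torus, constant mode; same operator-free ⟨n₀⟩_β). Open; intended suppliers: card
thermal-window-classical-infrared (μ ≪ T ≪ T_c: classical φ⁴₃ + FSS/Balaban), loop/cycle programmes,
any future T > 0 proof. True for v ≡ 0 (Ueltschi2006_zeroModeOccupation, proved in tree).
[difficulty: open-problem] (why it might fail: It is positive-temperature BEC in the thermodynamic
limit for an interacting continuum gas — open; only T_c upper bounds (SeiringerUeltschi2009) and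
GP-scaling limits (DeuchertSeiringer2020) are proved; needs d = 3 explicitly (Hohenberg) and β above
β_c(ρ) ≍ ρ^(-2/3).) [LiebSeiringerSolovejYngvason2005, SeiringerUeltschi2009, DeuchertSeiringer2020,
Seiringer2013, HaberbergerEtAl2023, FournaisEtAl2024, Ueltschi2006]
#4 XYThermalMonotonicity (crux) — (card M1, first typable lattice instance, where BEC is a THEOREM
at both ends: KLS1988PRL ground state d ≥ 2, DysonLiebSimon1978 Thm 4.2 low T d ≥ 3) for the S = ½
ferromagnetic quantum XY model = hard-core bosons at zero chemical potential on the torus (ℤ/Lℤ)^d,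
d ≥ 2, any L ≥ 1: β ↦ Σ_(x,y) Re⟨S¹_xS¹_y + S²_xS²_y⟩_(β,L) = ⟨(S¹_tot)² + (S²_tot)²⟩_β (the summed
one-particle density matrix, xyCorrTorus) is non-decreasing on [0, ∞). Exactly the combination
BenassiLeesUeltschi2016 leave unsigned (∂_(J¹) ≥ 0, ∂_(J²) ≤ 0). [difficulty: M] (why it might fail:
BLU2016 Thm 1: ∂_J¹⟨S¹S¹⟩ ≥ 0 but ∂_J²⟨S¹S¹⟩ ≤ 0, so d/dβ is a difference of positive terms; quantum
Griffiths II can fail (HurstSherman1969); a small torus whose first excited level has larger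
(S¹_tot)²+(S²_tot)² than the GS (cf. SpitzerStarrTran2012 on rings) kills the all-L claim.)
[BenassiLeesUeltschi2016, arXiv:1510.03215, Gallavotti1971, HurstSherman1969, KLS1988PRL,
DysonLiebSimon1978, NachtergaeleSpitzerStarr2004, SpitzerStarrTran2012]
#5 BoundaryTransferWeak (crux) — (shared verbatim with route BECPeriodicReduction, item
stmt-AtomisticToContinuum-0827) for each repulsive finite-range v, PeriodicBEC(v) — constant-mode
occupation ≥ cN for all δ-near-minimisers of the periodic energy on the torus of side (N/ρ)^(1/3), δ
after N — implies ∃ρ₀ > 0 ∀ρ ∈ (0,ρ₀) HasGroundStateBEC v ρ (Dirichlet ground state). The route's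
exit from the torus to the conjunct; not glue. [difficulty: L] (why it might fail: PeriodicBEC(v) is
ground-state-only (δ after N): the Dirichlet GS is a periodic trial state but lies a wall term ≫ δ
above E₀^per; interior restrictions are neither periodic nor of sharp N, so the hypothesis may never
fire (transfer ≈ conjunct). BEC is BC-sensitive: Robinson1976.) [LiebSeiringerSolovejYngvason2005,
Robinson1976, BoccatoSeiringer2023, Junge2026, LauwersVerbeureZagrebnov2003]
#9 ZeroTemperatureLimit (support) — (card M4, finite-volume zero-temperature limit, one-sided) for
every repulsive finite-range v, small ρ and large N with E₀^per(N,L) < ∞ (L = (N/ρ)^(1/3)): for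
every ε > 0, eventually as β → ∞, ⟨n₀⟩_(β,N,L) ≤ [sup_δ inf over δ-near-minimisers Ψ of the periodic
energy of ⟨Ψ,n₀Ψ⟩] + ε. Content: Peierls–Bogoliubov (near-Gibbs families exist, F > −∞ since Z < ∞),
Pinsker identification of near-Gibbs families with e^(−βH)/Z, compact resolvent + uniqueness of the
(positive) ground state at low density (connected hard-core configuration space), so ⟨n₀⟩_β →
⟨Ψ₀,n₀Ψ₀⟩ = the near-minimiser infimum. [difficulty: L] [LiebSeiringerSolovejYngvason2005,
ReedSimonIV1978, BratteliRobinsonII1997]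
#9 PeriodicGroundStateEnergyFinite (support) — for repulsive finite-range v (range R₀) there is ρ₀ >
0 such that for ρ < ρ₀ and all large N the periodic ground-state energy periodicGroundStateEnergy v
N ((N/ρ)^(1/3)) is finite: one symmetrised periodic C¹ trial state made of N disjoint bumps at
mutual (periodic) distance > R₀ has finite energy (periodic twin of BECPinning's
GroundStateEnergyFinite, stmt-AtomisticToContinuum-0850). Needed to leave the junk value ⟨n₀⟩_β = ⊤
of the operator-free definition when no finite-energy family exists. [difficulty: provable-now]
[LiebSeiringerSolovejYngvason2005, Fournais2020]
#9 IdealGasThermalMonotonicity (support) — (card M2, ideal-gas warm-up in the tree's Feynman-cycle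
vocabulary) for v = 0 the canonical zero-mode occupation ⟨n₀⟩_(Λ,N)(β) = Σ_(i=1..N)
Z_(N−i)(β)/Z_N(β) (zeroModeOccupation, canonicalZ of
Literature.Barriers.AtomisticToContinuum.FeynmanCyclesVersusCondensation) is non-decreasing in β > 0
for every N and every side L ≠ 0: d/dβ log(Z_(N−i)/Z_N) = ⟨H⟩_N − ⟨H⟩_(N−i) ≥ 0 because canonical
occupation numbers ⟨n_k⟩_N of the free Bose gas increase with N (Borrmann–Franke recursion /
canonicalZ_rec, canonicalZ_logConcave in tree). [difficulty: M] [Ueltschi2006, Suto2002,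
PuleZagrebnov2004]

TWO-LAYER PLAN. Foreseen glued splits (none filed now): ThermalMonotonicity ⇐
LatticeRegularisedMonotonicity (Bose–Hubbard on the torus (εℤ/Lℤ)³ with the
sampled v, all ε) → ContinuumLimitOfGibbsExpectations (ε → 0 at fixed N, L, β) →
ThermalMonotonicity; alternatively ThermalMonotonicity ⇐
KineticCovarianceNonpositive → InteractionCovarianceNonpositive → (sum) — only if a common cone
makes both signs provable.
ZeroTemperatureLimit ⇐ NearGibbsFamiliesExist (Peierls–Bogoliubov, Z < ∞) → GibbsIdentification
(Pinsker, spectral gap, unique positive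
ground state) → ZeroTemperatureLimit. ThermalBEC ⇐ (thermal-window engine, if that card is routed)
DimensionalReduction → ClassicalLRO →
ThermalBEC, or attach ThermalBEC to that route as a shared item.

KILL CRITERIA. ¬ThermalMonotonicity for some admissible v at all small ρ along infinitely many N (an
ED-visible re-entrant condensation on heating that
survives dilution and N → ∞) closes the route `refuted:ThermalMonotonicity` UNLESS the witness
leaves the eventual form (M_T′)
n₀(Ψ₀) ≥ sup_β⟨n₀⟩_β − o(N) intact — then pivot: restate rank 2 as GroundStateMostCondensed (⟨n₀⟩_β
≤ G + o(N)), which is all the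
Assembly uses. ¬XYThermalMonotonicity on small tori is a probe failure: restate with L ≥ L₀(d) or
drop (not load-bearing); a violation
persisting for large L in d = 3 kills the mechanism and closes the route. ¬BoundaryTransferWeak
(shared with BECPeriodicReduction) forces a
pivot to Dirichlet thermal states (definition request below, mode = Dirichlet ground mode).
ThermalBEC is conditional: its refutation in
d = 3 would overturn physics and closes everything thermal; its proof elsewhere plus rank 2 closes
the conjunct. PeriodicBEC
(stmt-AtomisticToContinuum-0826) or the conjunct proved by another route moots this one.

NOT DECOMPOSED YET. The proof strategy for rank 2 (Ginibre duplication with the U(1)-symmetric cone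
S⁺⊗S⁻ + S⁻⊗S⁺; FKG/association for winding versus
energy estimators of the Feynman–Kac loop measure; lattice regularisation + continuum limit) —
layer-2 children only after the ED scan
and the XY probe report. The analytic content of ZeroTemperatureLimit (Peierls bound, Pinsker
identification, gap, uniqueness/positivity
of the torus ground state at low density incl. connectedness of the hard-core configuration space).
ThermalBEC is deliberately NOT
decomposed here: it is another card's route (thermal-window-classical-infrared P1–P3) or any future
T > 0 proof. Dirichlet/thermal
variants and the mode-free λ_max form (λ_max is convex in γ, not obviously monotone in β — the
card's own caution) are not filed.

CHEAPEST FALSIFIER. Exact diagonalisation, minutes of numpy: f(β) = ⟨O⟩_β and f′(β) = −Cov_β(H, O)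
exactly from the spectrum, on (i) S = ½ XY tori (chains
L ≤ 14, 2×2…3×4, 2×2×2, 2×2×3; full trace = xyCorrTorus and per particle-number sector), O =
(S¹_tot)² + (S²_tot)²; (ii) the same with
staggered field λ ∈ {¼,…,4} and uniform μ; (iii) Bose–Hubbard N ≤ 6 on 3×3, 3×4, 2×2×2, chains, U ∈
{1,4,10,50}, O = n₀; (iv) S = 1 XY small
clusters; report min_β f′ and the large-β level test O(Ψ₀) ≥ O(Ψ₁). The script is written (this
planner's folder,
ed/thermal_monotonicity_ed.py) but was NOT run: the compute daemon socket was absent for the whole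
session (kit compute submit rc 2,
"computed socket absent"). Refuters: run it first. Hand checks done: L = 2 chain (f = 2t/(t+1), t =
e^{β/2}) and the triangle
(f′ ∝ 8a + 36ab + 4b > 0) are monotone. One robust violation on a d ≥ 2 torus refutes
XYThermalMonotonicity as typed; a violation for
Bose–Hubbard at small filling that persists as N grows is evidence against ThermalMonotonicity
itself.

NUMBERS. Units ħ = 2m = k_B = 1. Free critical temperature T_c⁰ = 4π(ρ/ζ(3/2))^{2/3} ≈ 6.63 ρ^{2/3};
ideal-gas condensate fraction 1 − (T/T_c⁰)^{3/2}
(canonical zero-mode version: Ueltschi2006 Thm 4, proved in tree as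
ueltschi2006_zeroModeOccupation_holds); rigorous T_c UPPER bound
T_c ≤ T_c⁰(1 + C√(aρ^{1/3})) (SeiringerUeltschi2009); no lower bound / existence of BEC at any T > 0
for any interacting continuum gas.
Lattice: XY LRO for d ≥ 2 at T = 0, all S (KLS1988PRL), d ≥ 3 at large β (DysonLiebSimon1978 Thm
4.2); LSSY (11.26): staggered field
λ ≲ 0.960 in d = 3. Large-β sign of f′: p₀p₁(E₁ − E₀)(O(Ψ₀) − O(Ψ₁)). Items at open: 8 (4 cruxes, 3
support, 1 assembly).

DEFINITION REQUESTS. - thermalCondensateOccupation (topic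
Literature/MathematicalPhysics/QuantumManyBody, next to PeriodicBoseGas): the canonical Gibbs
  expectation ⟨n₀⟩_{β,N,L} of the constant-mode occupation on the torus, operator-free, EXACTLY the
inline term used by ThermalBEC /
  ThermalMonotonicity / ZeroTemperatureLimit (sup_{δ>0} inf over finite pairwise-orthogonal families
Ψ : Fin k → PeriodicTrialState N L with
  probability weights p, finite energies, whose free-energy functional Σ pᵢ (periodicEnergy v
Ψᵢ).toReal + β⁻¹ Σ pᵢ log pᵢ is within δ of every
  other admissible family, of Σ ofReal(pᵢ)·condensateOccupation N L Ψᵢ), with API: unfolding lemma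
(so the cruxes restate by rfl),
  ⟨n₀⟩ ≤ N, existence of δ-near-Gibbs families for every δ > 0 when periodicGroundStateEnergy ≠ ⊤
(Peierls–Bogoliubov + Z < ∞), monotone
  dependence of the inner infimum on δ. A Dirichlet twin (TrialState, mode = Dirichlet ground mode
of the box) is the pivot vocabulary if
  BoundaryTransferWeak dies. Filed with `ledger workitem add --kind definition` after open.
- No cite facts requested: KLS/DLS facts exist (kennedy_lieb_shastry_xy_ground/_thermal),
Ueltschi2006_zeroModeOccupation is proved.

Novelty: Searches (2026-08-15, this planner; searchd local index down (connection reset), OpenAlex 429,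
galaxy congested — recorded as run):
`lit search --source crossref "condensate fraction monotone temperature Bose gas rigorous"` (11
rows, physics estimates only:
doi:10.1103/physreva.54.r4633 Giorgini–Pitaevskii–Stringari, doi:10.1070/qe2000v030n05abeh001738,
doi:10.1103/physreve.76.051109);
`lit search --source crossref "Griffiths inequalities ferromagnetic Heisenberg model Hurst Sherman"`
(10 rows: HurstSherman1969 =
doi:10.1103/physrevlett.22.1357 quantum Griffiths-II counterexample, doi:10.1063/1.1665412, Sherman
CMP 1969); `lit search --source
crossref "ferromagnetic ordering of energy levels"` (8 rows: NachtergaeleSpitzerStarr2004,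
SpitzerStarrTran2012 counterexamples,
doi:10.1088/1742-5468/adaae2 ring violations 2025); `lit read arxiv:1510.03215` pp. 2–3
(BenassiLeesUeltschi2016 Thm 1, Cor 2: signs of
∂_{J¹}, ∂_{J²} only; the β-derivative of ⟨S¹S¹+S²S²⟩ is not signed); `lit frontier
AtomisticToContinuum --since 2021` (30 rows; BEC
descendants arXiv:2603.20776, arXiv:2510.20493, arXiv:2602.16566 — all T = 0 / energy methods); `lit
galaxy search --star all
"condensate fraction is a decreasing function of temperature"` (0 rows, service congested rc 3);
`ledger idea list` (110 cards of the
sub: only thermal-window-classical-infrared uses β, and it credits this card's M_T as its P4);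
`ledger negatives` (0). Plus the card's own
and AUDIT-14's searches (crossref/zbMATH: Griffiths/G  [refs: 10.1103/physreva.54.r4633, 10.1070/qe2000v030n05abeh001738, 10.1103/physreve.76.051109, 10.1103/physrevlett.22.1357, 10.1063/1.1665412, 10.1088/1742-5468/adaae2, 1510.03215, 2603.20776, 2510.20493, 2602.16566, doi:10.1103/physreva.54.r4633, doi:10.1070/qe2000v030n05abeh001738, doi:10.1103/physreve.76.051109, doi:10.1103/physrevlett.22.1357, doi:10.1063/1.1665412, doi:10.1088/1742-5468/adaae2, arxi]

Barriers (technique_class: correlation-inequality thermal-monotonicity bridge): - technique_class: correlation-inequality thermal-monotonicity bridge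
- Literature.Barriers.AtomisticToContinuum.SymmetryBreakingWithoutCondensate: the route is built on
this barrier's lesson (source/tilt deformations transport only upper bounds to λ = 0); no
gauge-breaking source, quasi-average or grand-canonical state is used — β is the deformation and its
physical end is the conjunct; the Narrow companion's type-III scenario lives in anisotropic boxes at
T > 0, while ThermalBEC is stated on cubes L = (N/ρ)^{1/3}, where the free gas condenses into the
single zero mode (Ueltschi2006_zeroModeOccupation, proved).
- Literature.Barriers.AtomisticToContinuum.KineticGapLengthScales: evaded — no energy window is
converted into depletion anywhere; the Narrow entry's Galilei-boost lemma binds energy-window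
certificates of size ≳ N/L², whereas the descent extracts the ground state through δ → 0 (sup_δ inf
over δ-near-minimisers) after a Gibbs-state bound at fixed β; the gap enters only
ZeroTemperatureLimit at FIXED (N, L), where it is harmless.
- Literature.Barriers.AtomisticToContinuum.EnergyAsymptoticsWithoutCondensation: evaded — energies
appear only inside the variational characterisation of the Gibbs state (free-energy functional of
trial families) and inside a covariance sign, never as asymptotics of E₀(N, L) or f(β, ρ).
- Literature.Barriers.AtomisticToContinuum.HohenbergLowDimension: consistent and explanatory — at
fixed T > 0 there is no BEC in d ≤ 2, so ThermalBEC is false t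

History (route lifecycle, newest last):
- 2026-08-15T13:40:58Z · CLOSED retired — not-a-thesis: assembly does not conclude the sub-problem Statement (operator:999:1257524)

sub-problem: BoseEinsteinCondensation · status: closed(retired) · opened planner-plancard-AtomisticToContinuum-BoseEin-82402888-0 2026-08-15T11:42:41Z · rev 0 · ledger route-AtomisticToContinuum-BECThermalMonotonicity
GENERATED by the gate from the ledger (D-0016/17). Provers cite these decls: `theorem foo : Summit.AtomisticToContinuum.BoseEinsteinCondensation.Theses.BECThermalMonotonicity.<Decl> := …` in Summits/AtomisticToContinuum/BoseEinsteinCondensation/Theorems/<Name>.lean.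
-/

namespace Summit.AtomisticToContinuum.BoseEinsteinCondensation.Theses.BECThermalMonotonicity

open scoped BigOperators Topology Manifold Classical MeasureTheory ProbabilityTheory Matrix InnerProductSpace ComplexConjugate ContinuousMap
open Filter Set Function TopologicalSpace MeasureTheory

attribute [summit_statement] _root_.BoseEinsteinCondensation

/-- item stmt-AtomisticToContinuum-5796 · crux · rank 2 · closed · moot by None · by planner
why it might fail: At fixed (N,L) the large-β sign is that of n₀(Ψ₀)−n₀(Ψ₁): one low collective level more condensed than the ground state (finite-N level crossing surviving dilution) refutes it; no Ginibre cone/FKG structure is known for the Bose loop measure; quantum Griffiths II fails in general (HurstSherman1969).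
sources: Ginibre1970, Gallavotti1971, BenassiLeesUeltschi2016, arXiv:1510.03215, HurstSherman1969, FrohlichPark1978
[crux] (card M1, torus form, dilute and eventual in N) for every repulsive finite-range v there is
ρ₀ > 0 such that for 0 < ρ < ρ₀ and all large N, with L = (N/ρ)^(1/3): for all 0 < β₁ ≤ β₂ the
canonical Gibbs expectation of the constant-mode occupation n₀ = a₀†a₀ satisfies ⟨n₀⟩_(β₁,N,L) ≤
⟨n₀⟩_(β₂,N,L) — heating only depletes; ⟨n₀⟩_β written operator-free as sup_δ inf over δ-near-Gibbs
finite orthonormal families of periodic trial states (Gibbs variational principle). [difficulty: L] -/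
@[route_item "route-AtomisticToContinuum-BECThermalMonotonicity"]
def ThermalMonotonicity : Prop :=
  ∀ v : ℝ → ENNReal, Literature.MathematicalPhysics.QuantumManyBody.BoseGas.IsRepulsiveFiniteRange v → ∃ ρ₀ : ℝ, 0 < ρ₀ ∧ ∀ ρ : ℝ, 0 < ρ → ρ < ρ₀ → ∀ᶠ N : ℕ in Filter.atTop, ∀ β₁ β₂ : ℝ, 0 < β₁ → β₁ ≤ β₂ → (⨆ (δ : ℝ) (_ : 0 < δ), ⨅ (k : ℕ) (Ψ : Fin k → Literature.MathematicalPhysics.QuantumManyBody.BoseGas.PeriodicTrialState N (Literature.MathematicalPhysics.QuantumManyBody.BoseGas.sideLength ρ N)) (p : Fin k → ℝ) (_ : ((∀ i, 0 ≤ p i) ∧ (∑ i, p i) = 1 ∧ (∀ i, Literature.MathematicalPhysics.QuantumManyBody.BoseGas.periodicEnergy v (Ψ i) ≠ ⊤) ∧ (∀ i j, i ≠ j → ∫ X in Literature.MathematicalPhysics.QuantumManyBody.BoseGas.cellN N (Literature.MathematicalPhysics.QuantumManyBody.BoseGas.sideLength ρ N), (starRingEnd ℂ) ((Ψ i).ψ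 X) * (Ψ j).ψ X = 0)) ∧ ∀ (k' : ℕ) (Ψ' : Fin k' → Literature.MathematicalPhysics.QuantumManyBody.BoseGas.PeriodicTrialState N (Literature.MathematicalPhysics.QuantumManyBody.BoseGas.sideLength ρ N)) (p' : Fin k' → ℝ), ((∀ i, 0 ≤ p' i) ∧ (∑ i, p' i) = 1 ∧ (∀ i, Literature.MathematicalPhysics.QuantumManyBody.BoseGas.periodicEnergy v (Ψ' i) ≠ ⊤) ∧ (∀ i j, i ≠ j → ∫ X in Literature.MathematicalPhysics.QuantumManyBody.BoseGas.cellN N (Literature.MathematicalPhysics.QuantumManyBody.BoseGas.sideLength ρ N), (starRingEnd ℂ) ((Ψ' i).ψ X) * (Ψ' j).ψ X = 0)) → ((∑ i, p i * (Literature.MathematicalPhysics.QuantumManyBody.BoseGas.periodicEnergy v (Ψ i)).toReal) + (β₁)⁻¹ * (∑ i, p i * Real.log (p i))) ≤ ((∑ i, p' i * (Literature.MathematicalPhysics.QuantumManyBody.BoseGas.periodicEnergy v (Ψ' i)).toReal) + (β₁)⁻¹ * (∑ i, p' i * Real.log (p' i))) + δ), ∑ i, ENNReal.ofReal (p i) *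 Literature.MathematicalPhysics.QuantumManyBody.BoseGas.condensateOccupation N (Literature.MathematicalPhysics.QuantumManyBody.BoseGas.sideLength ρ N) (Ψ i).ψ) ≤ (⨆ (δ : ℝ) (_ : 0 < δ), ⨅ (k : ℕ) (Ψ : Fin k → Literature.MathematicalPhysics.QuantumManyBody.BoseGas.PeriodicTrialState N (Literature.MathematicalPhysics.QuantumManyBody.BoseGas.sideLength ρ N)) (p : Fin k → ℝ) (_ : ((∀ i, 0 ≤ p i) ∧ (∑ i, p i) = 1 ∧ (∀ i, Literature.MathematicalPhysics.QuantumManyBody.BoseGas.periodicEnergy v (Ψ i) ≠ ⊤) ∧ (∀ i j, i ≠ j → ∫ X in Literature.MathematicalPhysics.QuantumManyBody.BoseGas.cellN N (Literature.MathematicalPhysics.QuantumManyBody.BoseGas.sideLength ρ N), (starRingEnd ℂ) ((Ψ i).ψ X) * (Ψ j).ψ X = 0)) ∧ ∀ (k' : ℕ) (Ψ' : Fin k' → Literature.MathematicalPhysics.QuantumManyBody.BoseGas.PeriodicTrialState N (Literature.MathematicalPhysics.QuantumManyBody.BoseGas.sideLength ρ N)) (p' : Fin k' → ℝ), ((∀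 i, 0 ≤ p' i) ∧ (∑ i, p' i) = 1 ∧ (∀ i, Literature.MathematicalPhysics.QuantumManyBody.BoseGas.periodicEnergy v (Ψ' i) ≠ ⊤) ∧ (∀ i j, i ≠ j → ∫ X in Literature.MathematicalPhysics.QuantumManyBody.BoseGas.cellN N (Literature.MathematicalPhysics.QuantumManyBody.BoseGas.sideLength ρ N), (starRingEnd ℂ) ((Ψ' i).ψ X) * (Ψ' j).ψ X = 0)) → ((∑ i, p i * (Literature.MathematicalPhysics.QuantumManyBody.BoseGas.periodicEnergy v (Ψ i)).toReal) + (β₂)⁻¹ * (∑ i, p i * Real.log (p i))) ≤ ((∑ i, p' i * (Literature.MathematicalPhysics.QuantumManyBody.BoseGas.periodicEnergy v (Ψ' i)).toReal) + (β₂)⁻¹ * (∑ i, p' i * Real.log (p' i))) + δ), ∑ i, ENNReal.ofReal (p i) * Literature.MathematicalPhysics.QuantumManyBody.BoseGas.condensateOccupation N (Literature.MathematicalPhysics.QuantumManyBody.BoseGas.sideLength ρ N) (Ψ i).ψ)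

/-- item stmt-AtomisticToContinuum-5797 · crux · rank 3 · closed · moot by None · by planner
why it might fail: It is positive-temperature BEC in the thermodynamic limit for an interacting continuum gas — open; only T_c upper bounds (SeiringerUeltschi2009) and GP-scaling limits (DeuchertSeiringer2020) are proved; needs d = 3 explicitly (Hohenberg) and β above β_c(ρ) ≍ ρ^(-2/3).
sources: LiebSeiringerSolovejYngvason2005, SeiringerUeltschi2009, DeuchertSeiringer2020, Seiringer2013, HaberbergerEtAl2023, FournaisEtAl2024
[crux] (card M3; the CONDITIONAL input) positive-temperature BEC at ONE temperature, uniformly in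
the particle number: for every repulsive finite-range v there is ρ₀ > 0 such that for 0 < ρ < ρ₀
there are β > 0 and c > 0 with ⟨n₀⟩_(β,N,(N/ρ)^(1/3)) ≥ cN for all large N (canonical Gibbs state on
the torus, constant mode; same operator-free ⟨n₀⟩_β). Open; intended suppliers: card
thermal-window-classical-infrared (μ ≪ T ≪ T_c: classical φ⁴₃ + FSS/Balaban), loop/cycle programmes,
any future T > 0 proof. True for v ≡ 0 (Ueltschi2006_zeroModeOccupation, proved in tree).
[difficulty: open-problem] -/
@[route_item "route-AtomisticToContinuum-BECThermalMonotonicity"]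
def ThermalBEC : Prop :=
  ∀ v : ℝ → ENNReal, Literature.MathematicalPhysics.QuantumManyBody.BoseGas.IsRepulsiveFiniteRange v → ∃ ρ₀ : ℝ, 0 < ρ₀ ∧ ∀ ρ : ℝ, 0 < ρ → ρ < ρ₀ → ∃ β : ℝ, 0 < β ∧ ∃ c : ℝ, 0 < c ∧ ∀ᶠ N : ℕ in Filter.atTop, ENNReal.ofReal (c * N) ≤ (⨆ (δ : ℝ) (_ : 0 < δ), ⨅ (k : ℕ) (Ψ : Fin k → Literature.MathematicalPhysics.QuantumManyBody.BoseGas.PeriodicTrialState N (Literature.MathematicalPhysics.QuantumManyBody.BoseGas.sideLength ρ N)) (p : Fin k → ℝ) (_ : ((∀ i, 0 ≤ p i) ∧ (∑ i, p i) = 1 ∧ (∀ i, Literature.MathematicalPhysics.QuantumManyBody.BoseGas.periodicEnergy v (Ψ i) ≠ ⊤) ∧ (∀ i j, i ≠ j → ∫ X in Literature.MathematicalPhysics.QuantumManyBody.BoseGas.cellN N (Literature.MathematicalPhysics.QuantumManyBody.BoseGas.sideLength ρ N), (starRingEnd ℂ) ((Ψ i).ψ X) * (Ψ j).ψ X = 0))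 ∧ ∀ (k' : ℕ) (Ψ' : Fin k' → Literature.MathematicalPhysics.QuantumManyBody.BoseGas.PeriodicTrialState N (Literature.MathematicalPhysics.QuantumManyBody.BoseGas.sideLength ρ N)) (p' : Fin k' → ℝ), ((∀ i, 0 ≤ p' i) ∧ (∑ i, p' i) = 1 ∧ (∀ i, Literature.MathematicalPhysics.QuantumManyBody.BoseGas.periodicEnergy v (Ψ' i) ≠ ⊤) ∧ (∀ i j, i ≠ j → ∫ X in Literature.MathematicalPhysics.QuantumManyBody.BoseGas.cellN N (Literature.MathematicalPhysics.QuantumManyBody.BoseGas.sideLength ρ N), (starRingEnd ℂ) ((Ψ' i).ψ X) * (Ψ' j).ψ X = 0)) → ((∑ i, p i * (Literature.MathematicalPhysics.QuantumManyBody.BoseGas.periodicEnergy v (Ψ i)).toReal) + (β)⁻¹ * (∑ i, p i * Real.log (p i))) ≤ ((∑ i, p' i * (Literature.MathematicalPhysics.QuantumManyBody.BoseGas.periodicEnergy v (Ψ' i)).toReal) + (β)⁻¹ * (∑ i, p' i * Real.log (p' i))) + δ), ∑ i, ENNReal.ofReal (p i) * Literature.MathematicalPhysics.QuantumManyBody.BoseGas.condensateOccupation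 N (Literature.MathematicalPhysics.QuantumManyBody.BoseGas.sideLength ρ N) (Ψ i).ψ)

/-- item stmt-AtomisticToContinuum-5798 · crux · rank 4 · closed · moot by None · by planner
why it might fail: BLU2016 Thm 1: ∂_J¹⟨S¹S¹⟩ ≥ 0 but ∂_J²⟨S¹S¹⟩ ≤ 0, so d/dβ is a difference of positive terms; quantum Griffiths II can fail (HurstSherman1969); a small torus whose first excited level has larger (S¹_tot)²+(S²_tot)² than the GS (cf. SpitzerStarrTran2012 on rings) kills the all-L claim.
sources: BenassiLeesUeltschi2016, arXiv:1510.03215, Gallavotti1971, HurstSherman1969, KLS1988PRL, DysonLiebSimon1978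
[crux] (card M1, first typable lattice instance, where BEC is a THEOREM at both ends: KLS1988PRL
ground state d ≥ 2, DysonLiebSimon1978 Thm 4.2 low T d ≥ 3) for the S = ½ ferromagnetic quantum XY
model = hard-core bosons at zero chemical potential on the torus (ℤ/Lℤ)^d, d ≥ 2, any L ≥ 1: β ↦
Σ_(x,y) Re⟨S¹_xS¹_y + S²_xS²_y⟩_(β,L) = ⟨(S¹_tot)² + (S²_tot)²⟩_β (the summed one-particle density
matrix, xyCorrTorus) is non-decreasing on [0, ∞). Exactly the combination BenassiLeesUeltschi2016
leave unsigned (∂_(J¹) ≥ 0, ∂_(J²) ≤ 0). [difficulty: M] -/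
@[route_item "route-AtomisticToContinuum-BECThermalMonotonicity"]
def XYThermalMonotonicity : Prop :=
  ∀ (d L : ℕ) [NeZero L], 2 ≤ d → MonotoneOn (fun β : ℝ => ∑ x : Literature.Probability.LatticeModels.TorusSite d L, ∑ y : Literature.Probability.LatticeModels.TorusSite d L, Literature.MathematicalPhysics.QuantumLattice.xyCorrTorus β L 1 x y) (Set.Ici 0)

/-- item stmt-AtomisticToContinuum-0827 · crux · rank 5 · open · by planner
why it might fail: PeriodicBEC(v) is ground-state-only (δ after N): the Dirichlet GS is a periodic trial state but lies a wall term ≫ δ above E₀^per; interior restrictions are neither periodic nor of sharp N, so the hypothesis may never fire (transfer ≈ conjunct). BEC is BC-sensitive: Robinson1976.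
sources: LiebSeiringerSolovejYngvason2005, Robinson1976, BoccatoSeiringer2023, Junge2026, LauwersVerbeureZagrebnov2003
[crux] BoundaryTransferWeak (mode-free boundary-condition transfer, per potential): for each
repulsive finite-range v, PeriodicBEC(v) implies ∃ρ₀>0 ∀ρ∈(0,ρ₀) HasGroundStateBEC v ρ (Dirichlet
ground state, λ_max(γ) ≥ cN via condensateNumber). Not glue: near-minimiser slacks are O(N/L²) while
Dirichlet/periodic energies differ by a boundary term ≫ N/L², so no energy-comparison proof;
expected route: Neumann bracketing of interior sub-boxes (−Δ_Dir ≥ ⊕−Δ_Neu, v ≥ 0) + a mode-free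
criterion (λ_max ≥ tr γ²/N). Only the ENERGY analogue is in print (LiebSeiringerSolovejYngvason2005
Ch. 2 after (2.8)). v ≡ 0: hypothesis and conclusion both true. -/
@[route_item "route-AtomisticToContinuum-BECThermalMonotonicity"]
def BoundaryTransferWeak : Prop :=
  ∀ v : ℝ → ENNReal, Literature.MathematicalPhysics.QuantumManyBody.BoseGas.IsRepulsiveFiniteRange v → (∃ ρ₀ : ℝ, 0 < ρ₀ ∧ ∀ ρ : ℝ, 0 < ρ → ρ < ρ₀ → ∃ c : ℝ, 0 < c ∧ ∀ᶠ N : ℕ in Filter.atTop, ∃ δ : ENNReal, 0 < δ ∧ ∀ Ψ : Literature.MathematicalPhysics.QuantumManyBody.BoseGas.PeriodicTrialState N (Literature.MathematicalPhysics.QuantumManyBody.BoseGas.sideLength ρ N), Literature.MathematicalPhysics.QuantumManyBody.BoseGas.periodicEnergy v Ψ ≤ Literature.MathematicalPhysics.QuantumManyBody.BoseGas.periodicGroundStateEnergy v N (Literature.MathematicalPhysics.QuantumManyBody.BoseGas.sideLength ρ N) + δ → ENNReal.ofReal (c * N) ≤ Literature.MathematicalPhysics.QuantumManyBody.BoseGas.condensateOccupation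 N (Literature.MathematicalPhysics.QuantumManyBody.BoseGas.sideLength ρ N) Ψ.ψ) → ∃ ρ₀ : ℝ, 0 < ρ₀ ∧ ∀ ρ : ℝ, 0 < ρ → ρ < ρ₀ → Literature.MathematicalPhysics.QuantumManyBody.BoseGas.HasGroundStateBEC v ρ

/-- item stmt-AtomisticToContinuum-3974 · support · rank 9 · closed · proved by Summit.AtomisticToContinuum.BoseEinsteinCondensation.Theorems.periodicEnergyFinite_proof (prover) · by planner
sources: LiebSeiringerSolovejYngvason2005, Fournais2020
[support] FINITENESS: for repulsive finite-range v (range R₀) there is ρ₀ > 0 with E₀^per(N,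
(N/ρ)^{1/3}) < ⊤ for ρ < ρ₀ and all large N (N bumps at mutual torus distance > R₀; or directly from
LSSY2005_upperBound_periodic_holds once scatteringLength v ≠ ⊤, cf. stmt-AtomisticToContinuum-0851).
Needed to subtract in ℝ≥0∞ and to make the near-minimiser hypotheses non-vacuous. [difficulty:
provable-now] -/
@[route_item "route-AtomisticToContinuum-BECThermalMonotonicity"]
def PeriodicGroundStateEnergyFinite : Prop :=
  ∀ v : ℝ → ENNReal, Literature.MathematicalPhysics.QuantumManyBody.BoseGas.IsRepulsiveFiniteRange v → ∃ ρ₀ : ℝ, 0 < ρ₀ ∧ ∀ ρ : ℝ, 0 < ρ → ρ < ρ₀ → ∀ᶠ N : ℕ in Filter.atTop, Literature.MathematicalPhysics.QuantumManyBody.BoseGas.periodicGroundStateEnergy v N (Literature.MathematicalPhysics.QuantumManyBody.BoseGas.sideLength ρ N) ≠ ⊤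

/-- item stmt-AtomisticToContinuum-5799 · support · rank 9 · closed · moot by None · by planner
sources: LiebSeiringerSolovejYngvason2005, ReedSimonIV1978, BratteliRobinsonII1997
[support] (card M4, finite-volume zero-temperature limit, one-sided) for every repulsive
finite-range v, small ρ and large N with E₀^per(N,L) < ∞ (L = (N/ρ)^(1/3)): for every ε > 0,
eventually as β → ∞, ⟨n₀⟩_(β,N,L) ≤ [sup_δ inf over δ-near-minimisers Ψ of the periodic energy of
⟨Ψ,n₀Ψ⟩] + ε. Content: Peierls–Bogoliubov (near-Gibbs families exist, F > −∞ since Z < ∞), Pinsker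
identification of near-Gibbs families with e^(−βH)/Z, compact resolvent + uniqueness of the
(positive) ground state at low density (connected hard-core configuration space), so ⟨n₀⟩_β →
⟨Ψ₀,n₀Ψ₀⟩ = the near-minimiser infimum. [difficulty: L] -/
@[route_item "route-AtomisticToContinuum-BECThermalMonotonicity"]
def ZeroTemperatureLimit : Prop :=
  ∀ v : ℝ → ENNReal, Literature.MathematicalPhysics.QuantumManyBody.BoseGas.IsRepulsiveFiniteRange v → ∃ ρ₀ : ℝ, 0 < ρ₀ ∧ ∀ ρ : ℝ, 0 < ρ → ρ < ρ₀ → ∀ᶠ N : ℕ in Filter.atTop, Literature.MathematicalPhysics.QuantumManyBody.BoseGas.periodicGroundStateEnergy v N (Literature.MathematicalPhysics.QuantumManyBody.BoseGas.sideLength ρ N) ≠ ⊤ → ∀ ε : ENNReal, 0 < ε → ∀ᶠ β : ℝ in Filter.atTop, (⨆ (δ : ℝ) (_ : 0 < δ), ⨅ (k : ℕ) (Ψ : Fin k → Literature.MathematicalPhysics.QuantumManyBody.BoseGas.PeriodicTrialState N (Literature.MathematicalPhysics.QuantumManyBody.BoseGas.sideLength ρ N)) (p : Fin k → ℝ) (_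 : ((∀ i, 0 ≤ p i) ∧ (∑ i, p i) = 1 ∧ (∀ i, Literature.MathematicalPhysics.QuantumManyBody.BoseGas.periodicEnergy v (Ψ i) ≠ ⊤) ∧ (∀ i j, i ≠ j → ∫ X in Literature.MathematicalPhysics.QuantumManyBody.BoseGas.cellN N (Literature.MathematicalPhysics.QuantumManyBody.BoseGas.sideLength ρ N), (starRingEnd ℂ) ((Ψ i).ψ X) * (Ψ j).ψ X = 0)) ∧ ∀ (k' : ℕ) (Ψ' : Fin k' → Literature.MathematicalPhysics.QuantumManyBody.BoseGas.PeriodicTrialState N (Literature.MathematicalPhysics.QuantumManyBody.BoseGas.sideLength ρ N)) (p' : Fin k' → ℝ), ((∀ i, 0 ≤ p' i) ∧ (∑ i, p' i) = 1 ∧ (∀ i, Literature.MathematicalPhysics.QuantumManyBody.BoseGas.periodicEnergy v (Ψ' i) ≠ ⊤) ∧ (∀ i j, i ≠ j → ∫ X in Literature.MathematicalPhysics.QuantumManyBody.BoseGas.cellN N (Literature.MathematicalPhysics.QuantumManyBody.BoseGas.sideLength ρ N), (starRingEnd ℂ) ((Ψ' i).ψ X) * (Ψ' j).ψ X = 0))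 → ((∑ i, p i * (Literature.MathematicalPhysics.QuantumManyBody.BoseGas.periodicEnergy v (Ψ i)).toReal) + (β)⁻¹ * (∑ i, p i * Real.log (p i))) ≤ ((∑ i, p' i * (Literature.MathematicalPhysics.QuantumManyBody.BoseGas.periodicEnergy v (Ψ' i)).toReal) + (β)⁻¹ * (∑ i, p' i * Real.log (p' i))) + δ), ∑ i, ENNReal.ofReal (p i) * Literature.MathematicalPhysics.QuantumManyBody.BoseGas.condensateOccupation N (Literature.MathematicalPhysics.QuantumManyBody.BoseGas.sideLength ρ N) (Ψ i).ψ) ≤ (⨆ (δ : ENNReal) (_ : 0 < δ), ⨅ (Ψ : Literature.MathematicalPhysics.QuantumManyBody.BoseGas.PeriodicTrialState N (Literature.MathematicalPhysics.QuantumManyBody.BoseGas.sideLength ρ N)) (_ : Literature.MathematicalPhysics.QuantumManyBody.BoseGas.periodicEnergy v Ψ ≤ Literature.MathematicalPhysics.QuantumManyBody.BoseGas.periodicGroundStateEnergy v N (Literature.MathematicalPhysics.QuantumManyBody.BoseGas.sideLength ρ N) + δ), Literature.MathematicalPhysics.QuantumManyBody.BoseGas.condensateOccupation N (Literature.MathematicalPhysics.QuantumManyBody.BoseGas.sideLength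 ρ N) Ψ.ψ) + ε

/-- item stmt-AtomisticToContinuum-5800 · support · rank 9 · closed · moot by None · by planner
sources: Ueltschi2006, Suto2002, PuleZagrebnov2004
[support] (card M2, ideal-gas warm-up in the tree's Feynman-cycle vocabulary) for v = 0 the
canonical zero-mode occupation ⟨n₀⟩_(Λ,N)(β) = Σ_(i=1..N) Z_(N−i)(β)/Z_N(β) (zeroModeOccupation,
canonicalZ of Literature.Barriers.AtomisticToContinuum.FeynmanCyclesVersusCondensation) is
non-decreasing in β > 0 for every N and every side L ≠ 0: d/dβ log(Z_(N−i)/Z_N) = ⟨H⟩_N − ⟨H⟩_(N−i)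
≥ 0 because canonical occupation numbers ⟨n_k⟩_N of the free Bose gas increase with N
(Borrmann–Franke recursion / canonicalZ_rec, canonicalZ_logConcave in tree). [difficulty: M] -/
@[route_item "route-AtomisticToContinuum-BECThermalMonotonicity"]
def IdealGasThermalMonotonicity : Prop :=
  ∀ L : ℝ, L ≠ 0 → ∀ N : ℕ, MonotoneOn (fun β : ℝ => Literature.Barriers.AtomisticToContinuum.BoseGas.IdealGas.zeroModeOccupation β L N) (Set.Ioi 0)

/-- item stmt-AtomisticToContinuum-5801 · assembly · rank 1 · closed · moot by None · by planner
sources: LiebSeiringerSolovejYngvason2005, KLS1988PRL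
[assembly] ThermalMonotonicity → ZeroTemperatureLimit → PeriodicGroundStateEnergyFinite → ThermalBEC
→ BoundaryTransferWeak → BoseEinsteinCondensation (the sub-problem statement =
Literature.MathematicalPhysics.QuantumManyBody.BoseGas.BoseEinsteinCondensation). -/
@[route_item "route-AtomisticToContinuum-BECThermalMonotonicity"]
def Assembly : Prop :=
  ThermalMonotonicity → ZeroTemperatureLimit → PeriodicGroundStateEnergyFinite → ThermalBEC → BoundaryTransferWeak → Literature.MathematicalPhysics.QuantumManyBody.BoseGas.BoseEinsteinCondensation

end Summit.AtomisticToContinuum.BoseEinsteinCondensation.Theses.BECThermalMonotonicity
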